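import Summits.QuantumFields.YangMills.Theorems.ColdStartUniversalityLatticeLangevinPlaquetteFirstVariation
import Summits.QuantumFields.YangMills.Theorems.ColdStartUniversalityLatticeLangevinNoiseFrame
import HarnessLib

/-!
# Route `ColdStartUniversality` (fixed-cut-off package, Bakry–Émery side): WORD CALCULUS — the derivative of a product of link matrices
# (and their adjoints) in a ONE-LINK direction, with the trace bound `|Re tr(P·D·S)| ≤ m_e(w)·(t‖H‖² + N/t)/2`

Helper file (seat `ym-line-csu-p1`, g27; `--supports stmt-QuantumFields-24809`).  Generic tool for carré-du-champ bounds of Wilson-LOOP observables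
(words `w = a₁⋯a_n` of letters `(e, ±)`, read as `Q_e` or `Q_eᴴ` on the matrix configuration `Q = rebuild y`):
* `word_mem_unitaryGroup` — a word in unitary letters is unitary;
* ★★ `word_fderiv_trace_bound` — for a coordinate vector `y₀` with unitary links, a direction `v` supported on ONE link `e` (`rebuild v = δ_e H`),
  unitary `P, S` and every `t > 0`: the word map `y ↦ Π_k letter_k(rebuild y)` is differentiable at `y₀` and
  `|Re tr(P · D(word)(y₀)[v] · S)| ≤ #{k : edge(a_k) = e} · (t‖H‖² + N/t)/2`
  (Leibniz rule `HasFDerivAt.mul'`, `|Re tr(X W)| ≤ (t‖X‖² + N/t)/2` for unitary `W`, `‖Hᴴ‖ = ‖H‖`).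
The intended use (next file): `H = √2·𝐩E_ν·Q_e` (`‖H‖² ≤ 2`, `t = 1`) gives `|W_(e,ν)(Re tr w)| ≤ 2·m_e(w)` on `SU(2)^E`, whence
`Γ((1/L³)Σ_x W_(ℓ+x)) = O(|ℓ|²/L³)` for translation-averaged loops.  THEOREMS ONLY, no definition, no sorry.  HONEST FRAMING: fixed-cut-off
plumbing; nothing K-uniform; no crux, rung or summit statement is proved; the Yang–Mills mass gap is NOT proved.
-/

set_option autoImplicit false

noncomputable section

namespace Summit.QuantumFields.YangMills.Theorems.ColdStartUniversality

open MeasureTheory Matrix Complex Finset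
open scoped ComplexConjugate BigOperators Matrix
open Literature.MathematicalPhysics.QuantumFieldTheory
open Literature.MathematicalPhysics.QuantumLattice (fundamentalRep fundamentalLatticeRep continuous_fundamentalRep fundamentalRep_apply)
open Summit.Ventures.YMGap.HessianSharp (frobSq frobSq_neg frobSq_nonneg frobSq_conjTranspose mul_conjTranspose_self_of_mem
  conjTranspose_mem_unitaryGroup frobSq_mul_of_mul_conjTranspose reTrCLM)

section Calculus

set_option backward.isDefEq.respectTransparency false

open scoped Matrix.Norms.Operator

variable {L : ℕ} [NeZero L]

omit [NeZero L] in
/-- A word in unitary letters is unitary. [folklore] -/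
theorem word_mem_unitaryGroup (M : (Edge 3 L → Matrix (Fin (fundamentalLatticeRep 2).N) (Fin (fundamentalLatticeRep 2).N) ℂ)) (hM : ∀ e, M e ∈ Matrix.unitaryGroup (Fin (fundamentalLatticeRep 2).N) ℂ) :
    ∀ l : List (Edge 3 L × Bool), (l.map (fun a : Edge 3 L × Bool => if a.2 then (M a.1)ᴴ else M a.1)).prod ∈ Matrix.unitaryGroup (Fin (fundamentalLatticeRep 2).N) ℂ
  | [] => by
      rw [List.map_nil, List.prod_nil]
      exact (Matrix.unitaryGroup (Fin (fundamentalLatticeRep 2).N) ℂ).one_mem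
  | (e', false) :: l => by
      rw [List.map_cons, List.prod_cons]
      simp only [Bool.false_eq_true, if_false]
      exact mul_mem (hM e') (word_mem_unitaryGroup M hM l)
  | (e', true) :: l => by
      rw [List.map_cons, List.prod_cons]
      simp only [if_true]
      exact mul_mem (conjTranspose_mem_unitaryGroup (hM e')) (word_mem_unitaryGroup M hM l)

/-- ★★ **Leibniz rule and trace bound for a word in a one-link direction.**  Let `y₀` be a coordinate vector whose rebuilt links are unitary,
`v` a direction with `rebuild v = δ_e H`, and `t > 0`.  Then for every word `l` and all unitary `P, S`: the word map is differentiable at `y₀` and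
`|Re tr(P · D(word_l)(y₀)[v] · S)| ≤ (l.countP (·.1 = e)) · (t‖H‖² + N/t)/2`. [folklore] -/
theorem word_fderiv_trace_bound (y₀ v : (Edge 3 L × Fin (fundamentalLatticeRep 2).N × Fin (fundamentalLatticeRep 2).N × Bool → ℝ)) (e : Edge 3 L) (H : Matrix (Fin (fundamentalLatticeRep 2).N) (Fin (fundamentalLatticeRep 2).N) ℂ)
    (hU : ∀ e', (fun (ee : Edge 3 L) => Matrix.of fun (i j : Fin (fundamentalLatticeRep 2).N) => ((y₀ (ee, i, j, false) : ℝ) : ℂ) + ((y₀ (ee, i, j, true) : ℝ) : ℂ) * Complex.I) e' ∈ Matrix.unitaryGroup (Fin (fundamentalLatticeRep 2).N) ℂ)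
    (hv : (fun (ee : Edge 3 L) => Matrix.of fun (i j : Fin (fundamentalLatticeRep 2).N) => ((v (ee, i, j, false) : ℝ) : ℂ) + ((v (ee, i, j, true) : ℝ) : ℂ) * Complex.I) = fun e' => if e' = e then H else 0) {t : ℝ} (ht : 0 < t) :
    ∀ (l : List (Edge 3 L × Bool)) (P S : Matrix (Fin (fundamentalLatticeRep 2).N) (Fin (fundamentalLatticeRep 2).N) ℂ), P ∈ Matrix.unitaryGroup (Fin (fundamentalLatticeRep 2).N) ℂ → S ∈ Matrix.unitaryGroup (Fin (fundamentalLatticeRep 2).N) ℂ →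
      DifferentiableAt ℝ (fun y : (Edge 3 L × Fin (fundamentalLatticeRep 2).N × Fin (fundamentalLatticeRep 2).N × Bool → ℝ) => (l.map (fun a : Edge 3 L × Bool => if a.2 then ((fun (ee : Edge 3 L) => Matrix.of fun (i j : Fin (fundamentalLatticeRep 2).N) => ((y (ee, i, j, false) : ℝ) : ℂ) + ((y (ee, i, j, true) : ℝ) : ℂ) * Complex.I) a.1)ᴴ else (fun (ee : Edge 3 L) => Matrix.of fun (i j : Fin (fundamentalLatticeRep 2).N) => ((y (ee, i, j, false) : ℝ) : ℂ) + ((y (ee, i, j, true) : ℝ) : ℂ) * Complex.I) a.1)).prod) y₀ ∧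
      |(P * fderiv ℝ (fun y : (Edge 3 L × Fin (fundamentalLatticeRep 2).N × Fin (fundamentalLatticeRep 2).N × Bool → ℝ) => (l.map (fun a : Edge 3 L × Bool => if a.2 then ((fun (ee : Edge 3 L) => Matrix.of fun (i j : Fin (fundamentalLatticeRep 2).N) => ((y (ee, i, j, false) : ℝ) : ℂ) + ((y (ee, i, j, true) : ℝ) : ℂ) * Complex.I) a.1)ᴴ else (fun (ee : Edge 3 L) => Matrix.of fun (i j : Fin (fundamentalLatticeRep 2).N) => ((y (ee, i, j, false) : ℝ) : ℂ) + ((y (ee, i, j, true) : ℝ) : ℂ) * Complex.I) a.1)).prod) y₀ v * S).trace.re| ≤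
        (l.countP fun a => a.1 = e) * ((t * frobSq H + Fintype.card (Fin (fundamentalLatticeRep 2).N) / t) / 2) := by
  classical
  -- the rebuilt links as continuous linear maps of the coordinates
  set reb : (Edge 3 L × Fin (fundamentalLatticeRep 2).N × Fin (fundamentalLatticeRep 2).N × Bool → ℝ) → (Edge 3 L → Matrix (Fin (fundamentalLatticeRep 2).N) (Fin (fundamentalLatticeRep 2).N) ℂ) := fun z => (fun (ee : Edge 3 L) => Matrix.of fun (i j : Fin (fundamentalLatticeRep 2).N) => ((z (ee, i, j, false) : ℝ) : ℂ) + ((z (ee, i, j, true) : ℝ) : ℂ) * Complex.I) with hreb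
  have r_add : ∀ z w : (Edge 3 L × Fin (fundamentalLatticeRep 2).N × Fin (fundamentalLatticeRep 2).N × Bool → ℝ), reb (z + w) = reb z + reb w := fun z w => rebuild_add z w
  have r_smul : ∀ (a : ℝ) (z : (Edge 3 L × Fin (fundamentalLatticeRep 2).N × Fin (fundamentalLatticeRep 2).N × Bool → ℝ)), reb (a • z) = (a : ℂ) • reb z := fun a z => rebuild_smul a z
  have cx : ∀ (a : ℝ) (W : Matrix (Fin (fundamentalLatticeRep 2).N) (Fin (fundamentalLatticeRep 2).N) ℂ), a • W = (a : ℂ) • W := fun a W => by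
    ext i j
    simp only [Matrix.smul_apply, Complex.real_smul, smul_eq_mul]
  let Rl : Edge 3 L → (Edge 3 L × Fin (fundamentalLatticeRep 2).N × Fin (fundamentalLatticeRep 2).N × Bool → ℝ) →ₗ[ℝ] Matrix (Fin (fundamentalLatticeRep 2).N) (Fin (fundamentalLatticeRep 2).N) ℂ := fun e' =>
    { toFun := fun z => reb z e'
      map_add' := fun z w => by
        show reb (z + w) e' = reb z e' + reb w e'
        rw [r_add]; rfl
      map_smul' := fun a z => by
        show reb (a • z) e' = a • reb z e'
        rw [r_smul, cx]; rfl }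
  let R : Edge 3 L → (Edge 3 L × Fin (fundamentalLatticeRep 2).N × Fin (fundamentalLatticeRep 2).N × Bool → ℝ) →L[ℝ] Matrix (Fin (fundamentalLatticeRep 2).N) (Fin (fundamentalLatticeRep 2).N) ℂ := fun e' => LinearMap.toContinuousLinearMap (Rl e')
  -- conjugate transpose as a continuous `ℝ`-linear map
  let CTl : Matrix (Fin (fundamentalLatticeRep 2).N) (Fin (fundamentalLatticeRep 2).N) ℂ →ₗ[ℝ] Matrix (Fin (fundamentalLatticeRep 2).N) (Fin (fundamentalLatticeRep 2).N) ℂ :=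
    { toFun := fun X => Xᴴ
      map_add' := fun X X' => Matrix.conjTranspose_add X X'
      map_smul' := fun a X => by
        rw [RingHom.id_apply]
        ext i j
        simp only [Matrix.conjTranspose_apply, Matrix.smul_apply, Complex.real_smul, star_mul', Complex.star_def,
          Complex.conj_ofReal] }
  let CT : Matrix (Fin (fundamentalLatticeRep 2).N) (Fin (fundamentalLatticeRep 2).N) ℂ →L[ℝ] Matrix (Fin (fundamentalLatticeRep 2).N) (Fin (fundamentalLatticeRep 2).N) ℂ := LinearMap.toContinuousLinearMap CTl
  -- induction on the word
  intro l
  induction l with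
  | nil =>
      intro P S _ _
      refine ⟨?_, ?_⟩
      · simp only [List.map_nil, List.prod_nil]
        exact differentiableAt_const _
      · have h0 : fderiv ℝ (fun y : (Edge 3 L × Fin (fundamentalLatticeRep 2).N × Fin (fundamentalLatticeRep 2).N × Bool → ℝ) => (([] : List (Edge 3 L × Bool)).map (fun a : Edge 3 L × Bool => if a.2 then ((reb y) a.1)ᴴ else (reb y) a.1)).prod) y₀ = 0 := by
          simp only [List.map_nil, List.prod_nil]
          exact fderiv_const_apply _
        rw [h0]
        simp only [_root_.zero_apply, Matrix.mul_zero, Matrix.trace_zero, Complex.zero_re, abs_zero,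
          List.countP_nil, Nat.cast_zero, zero_mul, le_refl]
  | cons a l ih =>
      obtain ⟨e', b⟩ := a
      cases b
      · -- letter `(false)`
        intro P S hP hS
        have hsplit : (fun y : (Edge 3 L × Fin (fundamentalLatticeRep 2).N × Fin (fundamentalLatticeRep 2).N × Bool → ℝ) => ((((e', false) : Edge 3 L × Bool) :: l).map (fun a : Edge 3 L × Bool => if a.2 then ((reb y) a.1)ᴴ else (reb y) a.1)).prod) =
            fun y => reb y e' * (l.map (fun a : Edge 3 L × Bool => if a.2 then ((reb y) a.1)ᴴ else (reb y) a.1)).prod := by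
          funext y
          rw [List.map_cons, List.prod_cons]
          simp only [Bool.false_eq_true, if_false]
        obtain ⟨hdl, -⟩ := ih 1 1 (Matrix.unitaryGroup (Fin (fundamentalLatticeRep 2).N) ℂ).one_mem (Matrix.unitaryGroup (Fin (fundamentalLatticeRep 2).N) ℂ).one_mem
        have hda : HasFDerivAt (fun y : (Edge 3 L × Fin (fundamentalLatticeRep 2).N × Fin (fundamentalLatticeRep 2).N × Bool → ℝ) => reb y e') (R e') y₀ := by
          have h1 : (fun y : (Edge 3 L × Fin (fundamentalLatticeRep 2).N × Fin (fundamentalLatticeRep 2).N × Bool → ℝ) => reb y e') = fun y => (R e') y := funext fun y => rfl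
          rw [h1]; exact (R e').hasFDerivAt
        have hprod := hda.mul' hdl.hasFDerivAt
        have hw : (l.map (fun a : Edge 3 L × Bool => if a.2 then ((reb y₀) a.1)ᴴ else (reb y₀) a.1)).prod ∈ Matrix.unitaryGroup (Fin (fundamentalLatticeRep 2).N) ℂ := word_mem_unitaryGroup (reb y₀) hU l
        have hA : reb y₀ e' ∈ Matrix.unitaryGroup (Fin (fundamentalLatticeRep 2).N) ℂ := hU e'
        refine ⟨by rw [hsplit]; exact hprod.differentiableAt, ?_⟩
        have hDv : (R e') v = reb v e' := rfl
        have hfd : fderiv ℝ (fun y : (Edge 3 L × Fin (fundamentalLatticeRep 2).N × Fin (fundamentalLatticeRep 2).N × Bool → ℝ) => reb y e' * (l.map (fun a : Edge 3 L × Bool => if a.2 then ((reb y) a.1)ᴴ else (reb y) a.1)).prod) y₀ =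
            reb y₀ e' • fderiv ℝ (fun y : (Edge 3 L × Fin (fundamentalLatticeRep 2).N × Fin (fundamentalLatticeRep 2).N × Bool → ℝ) => (l.map (fun a : Edge 3 L × Bool => if a.2 then ((reb y) a.1)ᴴ else (reb y) a.1)).prod) y₀ +
              (R e').smulRight ((l.map (fun a : Edge 3 L × Bool => if a.2 then ((reb y₀) a.1)ᴴ else (reb y₀) a.1)).prod) := hprod.fderiv
        rw [show fderiv ℝ (fun y : (Edge 3 L × Fin (fundamentalLatticeRep 2).N × Fin (fundamentalLatticeRep 2).N × Bool → ℝ) => ((((e', false) : Edge 3 L × Bool) :: l).map (fun a : Edge 3 L × Bool => if a.2 then ((reb y) a.1)ᴴ else (reb y) a.1)).prod) y₀ v =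
            reb y₀ e' * fderiv ℝ (fun y : (Edge 3 L × Fin (fundamentalLatticeRep 2).N × Fin (fundamentalLatticeRep 2).N × Bool → ℝ) => (l.map (fun a : Edge 3 L × Bool => if a.2 then ((reb y) a.1)ᴴ else (reb y) a.1)).prod) y₀ v +
              reb v e' * (l.map (fun a : Edge 3 L × Bool => if a.2 then ((reb y₀) a.1)ᴴ else (reb y₀) a.1)).prod by
          rw [hsplit, hfd, _root_.add_apply, _root_.smul_apply,
            ContinuousLinearMap.smulRight_apply, smul_eq_mul, hDv]
          rfl]
        rw [Matrix.mul_add, Matrix.add_mul, Matrix.trace_add, Complex.add_re]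
        -- first term: induction hypothesis with `P · letter`
        obtain ⟨-, h1⟩ := ih (P * reb y₀ e') S (mul_mem hP hA) hS
        have h1' : |(P * (reb y₀ e' * fderiv ℝ (fun y : (Edge 3 L × Fin (fundamentalLatticeRep 2).N × Fin (fundamentalLatticeRep 2).N × Bool → ℝ) => (l.map (fun a : Edge 3 L × Bool => if a.2 then ((reb y) a.1)ᴴ else (reb y) a.1)).prod) y₀ v) * S).trace.re| ≤
            (l.countP fun a => a.1 = e) * ((t * frobSq H + Fintype.card (Fin (fundamentalLatticeRep 2).N) / t) / 2) := by
          rw [← Matrix.mul_assoc]; exact h1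
        have hκ : 0 ≤ ((t * frobSq H + Fintype.card (Fin (fundamentalLatticeRep 2).N) / t) / 2) := by
          have := frobSq_nonneg H; positivity
        have hve : reb v e' = if e' = e then H else 0 := congrFun hv e'
        by_cases hae : e' = e
        · -- the letter sits on `e`: one extra `κ`
          have hcnt : (((((e', false) : Edge 3 L × Bool) :: l).countP fun a => a.1 = e : ℕ) : ℝ) = (l.countP fun a => a.1 = e : ℕ) + 1 := by
            simp [hae]
          rw [hcnt, add_mul, one_mul]
          rw [if_pos hae] at hve
          have hWu : (l.map (fun a : Edge 3 L × Bool => if a.2 then ((reb y₀) a.1)ᴴ else (reb y₀) a.1)).prod * S * P ∈ Matrix.unitaryGroup (Fin (fundamentalLatticeRep 2).N) ℂ := mul_mem (mul_mem hw hS) hP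
          have hcyc : (P * (reb v e' * (l.map (fun a : Edge 3 L × Bool => if a.2 then ((reb y₀) a.1)ᴴ else (reb y₀) a.1)).prod) * S).trace =
              (reb v e' * ((l.map (fun a : Edge 3 L × Bool => if a.2 then ((reb y₀) a.1)ᴴ else (reb y₀) a.1)).prod * S * P)).trace := by
            rw [Matrix.trace_mul_cycle, Matrix.trace_mul_comm]
            simp only [Matrix.mul_assoc]
          have h2 : |(P * (reb v e' * (l.map (fun a : Edge 3 L × Bool => if a.2 then ((reb y₀) a.1)ᴴ else (reb y₀) a.1)).prod) * S).trace.re| ≤ ((t * frobSq H + Fintype.card (Fin (fundamentalLatticeRep 2).N) / t) / 2) := by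
            rw [hcyc, hve]
            exact abs_re_trace_mul_right_le _ _ (mul_conjTranspose_self_of_mem hWu) ht
          exact (abs_add_le _ _).trans (add_le_add h1' h2)
        · -- the letter is elsewhere: its derivative in the direction `v` vanishes
          have hcnt : (((((e', false) : Edge 3 L × Bool) :: l).countP fun a => a.1 = e : ℕ) : ℝ) = (l.countP fun a => a.1 = e : ℕ) := by
            simp [hae]
          rw [hcnt]
          rw [if_neg hae] at hve
          rw [hve]
          simp only [Matrix.zero_mul, Matrix.mul_zero, Matrix.trace_zero, Complex.zero_re, add_zero]
          exact h1'

      · -- letter `(true)`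
        intro P S hP hS
        have hsplit : (fun y : (Edge 3 L × Fin (fundamentalLatticeRep 2).N × Fin (fundamentalLatticeRep 2).N × Bool → ℝ) => ((((e', true) : Edge 3 L × Bool) :: l).map (fun a : Edge 3 L × Bool => if a.2 then ((reb y) a.1)ᴴ else (reb y) a.1)).prod) =
            fun y => (reb y e')ᴴ * (l.map (fun a : Edge 3 L × Bool => if a.2 then ((reb y) a.1)ᴴ else (reb y) a.1)).prod := by
          funext y
          rw [List.map_cons, List.prod_cons]
          simp only [if_true]
        obtain ⟨hdl, -⟩ := ih 1 1 (Matrix.unitaryGroup (Fin (fundamentalLatticeRep 2).N) ℂ).one_mem (Matrix.unitaryGroup (Fin (fundamentalLatticeRep 2).N) ℂ).one_mem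
        have hda : HasFDerivAt (fun y : (Edge 3 L × Fin (fundamentalLatticeRep 2).N × Fin (fundamentalLatticeRep 2).N × Bool → ℝ) => (reb y e')ᴴ) (CT.comp (R e')) y₀ := by
          have h1 : (fun y : (Edge 3 L × Fin (fundamentalLatticeRep 2).N × Fin (fundamentalLatticeRep 2).N × Bool → ℝ) => (reb y e')ᴴ) = fun y => (CT.comp (R e')) y := funext fun y => rfl
          rw [h1]; exact (CT.comp (R e')).hasFDerivAt
        have hprod := hda.mul' hdl.hasFDerivAt
        have hw : (l.map (fun a : Edge 3 L × Bool => if a.2 then ((reb y₀) a.1)ᴴ else (reb y₀) a.1)).prod ∈ Matrix.unitaryGroup (Fin (fundamentalLatticeRep 2).N) ℂ := word_mem_unitaryGroup (reb y₀) hU l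
        have hA : (reb y₀ e')ᴴ ∈ Matrix.unitaryGroup (Fin (fundamentalLatticeRep 2).N) ℂ := conjTranspose_mem_unitaryGroup (hU e')
        refine ⟨by rw [hsplit]; exact hprod.differentiableAt, ?_⟩
        have hDv : (CT.comp (R e')) v = (reb v e')ᴴ := rfl
        have hfd : fderiv ℝ (fun y : (Edge 3 L × Fin (fundamentalLatticeRep 2).N × Fin (fundamentalLatticeRep 2).N × Bool → ℝ) => (reb y e')ᴴ * (l.map (fun a : Edge 3 L × Bool => if a.2 then ((reb y) a.1)ᴴ else (reb y) a.1)).prod) y₀ =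
            (reb y₀ e')ᴴ • fderiv ℝ (fun y : (Edge 3 L × Fin (fundamentalLatticeRep 2).N × Fin (fundamentalLatticeRep 2).N × Bool → ℝ) => (l.map (fun a : Edge 3 L × Bool => if a.2 then ((reb y) a.1)ᴴ else (reb y) a.1)).prod) y₀ +
              (CT.comp (R e')).smulRight ((l.map (fun a : Edge 3 L × Bool => if a.2 then ((reb y₀) a.1)ᴴ else (reb y₀) a.1)).prod) := hprod.fderiv
        rw [show fderiv ℝ (fun y : (Edge 3 L × Fin (fundamentalLatticeRep 2).N × Fin (fundamentalLatticeRep 2).N × Bool → ℝ) => ((((e', true) : Edge 3 L × Bool) :: l).map (fun a : Edge 3 L × Bool => if a.2 then ((reb y) a.1)ᴴ else (reb y) a.1)).prod) y₀ v =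
            (reb y₀ e')ᴴ * fderiv ℝ (fun y : (Edge 3 L × Fin (fundamentalLatticeRep 2).N × Fin (fundamentalLatticeRep 2).N × Bool → ℝ) => (l.map (fun a : Edge 3 L × Bool => if a.2 then ((reb y) a.1)ᴴ else (reb y) a.1)).prod) y₀ v +
              (reb v e')ᴴ * (l.map (fun a : Edge 3 L × Bool => if a.2 then ((reb y₀) a.1)ᴴ else (reb y₀) a.1)).prod by
          rw [hsplit, hfd, _root_.add_apply, _root_.smul_apply,
            ContinuousLinearMap.smulRight_apply, smul_eq_mul, hDv]
          rfl]
        rw [Matrix.mul_add, Matrix.add_mul, Matrix.trace_add, Complex.add_re]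
        -- first term: induction hypothesis with `P · letter`
        obtain ⟨-, h1⟩ := ih (P * (reb y₀ e')ᴴ) S (mul_mem hP hA) hS
        have h1' : |(P * ((reb y₀ e')ᴴ * fderiv ℝ (fun y : (Edge 3 L × Fin (fundamentalLatticeRep 2).N × Fin (fundamentalLatticeRep 2).N × Bool → ℝ) => (l.map (fun a : Edge 3 L × Bool => if a.2 then ((reb y) a.1)ᴴ else (reb y) a.1)).prod) y₀ v) * S).trace.re| ≤
            (l.countP fun a => a.1 = e) * ((t * frobSq H + Fintype.card (Fin (fundamentalLatticeRep 2).N) / t) / 2) := by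
          rw [← Matrix.mul_assoc]; exact h1
        have hκ : 0 ≤ ((t * frobSq H + Fintype.card (Fin (fundamentalLatticeRep 2).N) / t) / 2) := by
          have := frobSq_nonneg H; positivity
        have hve : reb v e' = if e' = e then H else 0 := congrFun hv e'
        by_cases hae : e' = e
        · -- the letter sits on `e`: one extra `κ`
          have hcnt : (((((e', true) : Edge 3 L × Bool) :: l).countP fun a => a.1 = e : ℕ) : ℝ) = (l.countP fun a => a.1 = e : ℕ) + 1 := by
            simp [hae]
          rw [hcnt, add_mul, one_mul]
          rw [if_pos hae] at hve
          have hWu : (l.map (fun a : Edge 3 L × Bool => if a.2 then ((reb y₀) a.1)ᴴ else (reb y₀) a.1)).prod * S * P ∈ Matrix.unitaryGroup (Fin (fundamentalLatticeRep 2).N) ℂ := mul_mem (mul_mem hw hS) hP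
          have hcyc : (P * ((reb v e')ᴴ * (l.map (fun a : Edge 3 L × Bool => if a.2 then ((reb y₀) a.1)ᴴ else (reb y₀) a.1)).prod) * S).trace =
              ((reb v e')ᴴ * ((l.map (fun a : Edge 3 L × Bool => if a.2 then ((reb y₀) a.1)ᴴ else (reb y₀) a.1)).prod * S * P)).trace := by
            rw [Matrix.trace_mul_cycle, Matrix.trace_mul_comm]
            simp only [Matrix.mul_assoc]
          have h2 : |(P * ((reb v e')ᴴ * (l.map (fun a : Edge 3 L × Bool => if a.2 then ((reb y₀) a.1)ᴴ else (reb y₀) a.1)).prod) * S).trace.re| ≤ ((t * frobSq H + Fintype.card (Fin (fundamentalLatticeRep 2).N) / t) / 2) := by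
            rw [hcyc, hve]
            rw [← frobSq_conjTranspose H]
            exact abs_re_trace_mul_right_le _ _ (mul_conjTranspose_self_of_mem hWu) ht
          exact (abs_add_le _ _).trans (add_le_add h1' h2)
        · -- the letter is elsewhere: its derivative in the direction `v` vanishes
          have hcnt : (((((e', true) : Edge 3 L × Bool) :: l).countP fun a => a.1 = e : ℕ) : ℝ) = (l.countP fun a => a.1 = e : ℕ) := by
            simp [hae]
          rw [hcnt]
          rw [if_neg hae] at hve
          rw [hve]
          simp only [Matrix.conjTranspose_zero, Matrix.zero_mul, Matrix.mul_zero, Matrix.trace_zero, Complex.zero_re, add_zero]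
          exact h1'


/-- ★ **The frame derivative of a loop word is bounded by twice the multiplicity of the link.**  On `SU(2)^E`, for every configuration `V`,
noise index `n = (e, ν)` and word `l`: `|D(y ↦ Re tr Π_k letter_k(rebuild y))(coords V)[σ_n(coords V)]| ≤ 2·#{k : edge(a_k) = e}`
(`σ_n(y) = coords δ_e(√2·𝐩E_ν·(rebuild y)_e)`, `‖√2 𝐩E_ν Q_e‖² ≤ 2`, `N = 2`, `t = 1` in `word_fderiv_trace_bound`). [folklore] -/
theorem word_frameDeriv_abs_le (V : (GaugeConfig 3 L (Matrix.specialUnitaryGroup (Fin 2) ℂ))) (n : Edge 3 L × NoiseIdx (fundamentalLatticeRep 2).N) (l : List (Edge 3 L × Bool)) :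
    |fderiv ℝ (fun y : (Edge 3 L × Fin (fundamentalLatticeRep 2).N × Fin (fundamentalLatticeRep 2).N × Bool → ℝ) => ((l.map (fun a : Edge 3 L × Bool => if a.2 then ((fun (ee : Edge 3 L) => Matrix.of fun (i j : Fin (fundamentalLatticeRep 2).N) => ((y (ee, i, j, false) : ℝ) : ℂ) + ((y (ee, i, j, true) : ℝ) : ℂ) * Complex.I) a.1)ᴴ else (fun (ee : Edge 3 L) => Matrix.of fun (i j : Fin (fundamentalLatticeRep 2).N) => ((y (ee, i, j, false) : ℝ) : ℂ) + ((y (ee, i, j, true) : ℝ) : ℂ) * Complex.I) a.1)).prod).trace.re) ((fun (V : GaugeConfig 3 L (Matrix.specialUnitaryGroup (Fin 2) ℂ)) (q : Edge 3 L × Fin (fundamentalLatticeRep 2).N × Fin (fundamentalLatticeRep 2).N × Bool) => (fun z : ℂ => if q.2.2.2 then z.im else z.re) ((fundamentalRep (Fin 2) (V q.1) : Matrix (Fin 2) (Fin 2) ℂ) q.2.1 q.2.2.1)) V) (fun q : Edge 3 L × Fin (fundamentalLatticeRep 2).N × Fin (fundamentalLatticeRep 2).N × Bool => if n.1 = q.1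 then (fun z : ℂ => if q.2.2.2 then z.im else z.re) (((Real.sqrt 2 : ℂ) • ((fundamentalLatticeRep 2).lieProj (noiseDir n.2) * (fun (ee : Edge 3 L) => Matrix.of fun (i j : Fin (fundamentalLatticeRep 2).N) => (((fun (V : GaugeConfig 3 L (Matrix.specialUnitaryGroup (Fin 2) ℂ)) (q : Edge 3 L × Fin (fundamentalLatticeRep 2).N × Fin (fundamentalLatticeRep 2).N × Bool) => (fun z : ℂ => if q.2.2.2 then z.im else z.re) ((fundamentalRep (Fin 2) (V q.1) : Matrix (Fin 2) (Fin 2) ℂ) q.2.1 q.2.2.1)) V (ee, i, j, false) : ℝ) : ℂ) + (((fun (V : GaugeConfig 3 L (Matrix.specialUnitaryGroup (Fin 2) ℂ)) (q : Edge 3 L × Fin (fundamentalLatticeRep 2).N × Fin (fundamentalLatticeRep 2).N × Bool) => (fun z : ℂ => if q.2.2.2 then z.im else z.re) ((fundamentalRep (Fin 2) (V q.1) : Matrix (Fin 2) (Fin 2) ℂ) q.2.1 q.2.2.1)) V (ee, i, j, true) : ℝ) : ℂ) * Complex.I) q.1)) q.2.1 q.2.2.1) else 0)|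
      ≤ 2 * (l.countP fun a => a.1 = n.1) := by
  classical
  set reb : (Edge 3 L × Fin (fundamentalLatticeRep 2).N × Fin (fundamentalLatticeRep 2).N × Bool → ℝ) → (Edge 3 L → Matrix (Fin (fundamentalLatticeRep 2).N) (Fin (fundamentalLatticeRep 2).N) ℂ) := fun z => (fun (ee : Edge 3 L) => Matrix.of fun (i j : Fin (fundamentalLatticeRep 2).N) => ((z (ee, i, j, false) : ℝ) : ℂ) + ((z (ee, i, j, true) : ℝ) : ℂ) * Complex.I) with hreb
  set y₀ : (Edge 3 L × Fin (fundamentalLatticeRep 2).N × Fin (fundamentalLatticeRep 2).N × Bool → ℝ) := (fun (V : GaugeConfig 3 L (Matrix.specialUnitaryGroup (Fin 2) ℂ)) (q : Edge 3 L × Fin (fundamentalLatticeRep 2).N × Fin (fundamentalLatticeRep 2).N × Bool) => (fun z : ℂ => if q.2.2.2 then z.im else z.re) ((fundamentalRep (Fin 2) (V q.1) : Matrix (Fin 2) (Fin 2) ℂ) q.2.1 q.2.2.1)) V with hy₀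
  set v : (Edge 3 L × Fin (fundamentalLatticeRep 2).N × Fin (fundamentalLatticeRep 2).N × Bool → ℝ) := (fun q : Edge 3 L × Fin (fundamentalLatticeRep 2).N × Fin (fundamentalLatticeRep 2).N × Bool => if n.1 = q.1 then (fun z : ℂ => if q.2.2.2 then z.im else z.re) (((Real.sqrt 2 : ℂ) • ((fundamentalLatticeRep 2).lieProj (noiseDir n.2) * (fun (ee : Edge 3 L) => Matrix.of fun (i j : Fin (fundamentalLatticeRep 2).N) => ((y₀ (ee, i, j, false) : ℝ) : ℂ) + ((y₀ (ee, i, j, true) : ℝ) : ℂ) * Complex.I) q.1)) q.2.1 q.2.2.1) else 0) with hvdef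
  set Pn : Matrix (Fin (fundamentalLatticeRep 2).N) (Fin (fundamentalLatticeRep 2).N) ℂ := (fundamentalLatticeRep 2).lieProj (noiseDir n.2) with hPn
  set H : Matrix (Fin (fundamentalLatticeRep 2).N) (Fin (fundamentalLatticeRep 2).N) ℂ := (Real.sqrt 2 : ℂ) • (Pn * reb y₀ n.1) with hH
  -- the links of `V` are unitary
  have hrebV : reb y₀ = fun e => Matrix.of fun i j : Fin (fundamentalLatticeRep 2).N => (fundamentalRep (Fin 2) (V e) : Matrix (Fin 2) (Fin 2) ℂ) i j :=
    rebuild_coords_of V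
  have hU : ∀ e', reb y₀ e' ∈ Matrix.unitaryGroup (Fin (fundamentalLatticeRep 2).N) ℂ := by
    intro e'
    rw [hrebV]
    exact Matrix.specialUnitaryGroup_le_unitaryGroup (V e').2
  -- the direction is supported on the link `n.1`
  have hv : reb v = fun e' => if e' = n.1 then H else 0 := by
    have h := rebuild_noise n y₀
    rw [hvdef]
    refine h.trans ?_
    funext e'
    by_cases he : e' = n.1
    · rw [if_pos he, if_pos he.symm, hH, he]
    · rw [if_neg he, if_neg (Ne.symm he)]
  -- the trace bound with `P = S = 1`, `t = 1`
  obtain ⟨hdiff, hb⟩ := word_fderiv_trace_bound y₀ v n.1 H hU hv one_pos l 1 1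
    (Matrix.unitaryGroup (Fin (fundamentalLatticeRep 2).N) ℂ).one_mem (Matrix.unitaryGroup (Fin (fundamentalLatticeRep 2).N) ℂ).one_mem
  rw [Matrix.one_mul, Matrix.mul_one, one_mul, div_one] at hb
  -- the derivative of `Re tr ∘ word`
  have hcomp : fderiv ℝ (fun y : (Edge 3 L × Fin (fundamentalLatticeRep 2).N × Fin (fundamentalLatticeRep 2).N × Bool → ℝ) => ((l.map (fun a : Edge 3 L × Bool => if a.2 then ((reb y) a.1)ᴴ else (reb y) a.1)).prod).trace.re) y₀ v =
      (fderiv ℝ (fun y : (Edge 3 L × Fin (fundamentalLatticeRep 2).N × Fin (fundamentalLatticeRep 2).N × Bool → ℝ) => (l.map (fun a : Edge 3 L × Bool => if a.2 then ((reb y) a.1)ᴴ else (reb y) a.1)).prod) y₀ v).trace.re := by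
    have h := (reTrCLM (n := Fin (fundamentalLatticeRep 2).N)).hasFDerivAt.comp y₀ hdiff.hasFDerivAt
    rw [show (fun y : (Edge 3 L × Fin (fundamentalLatticeRep 2).N × Fin (fundamentalLatticeRep 2).N × Bool → ℝ) => ((l.map (fun a : Edge 3 L × Bool => if a.2 then ((reb y) a.1)ᴴ else (reb y) a.1)).prod).trace.re) =
        (reTrCLM (n := Fin (fundamentalLatticeRep 2).N)) ∘ (fun y : (Edge 3 L × Fin (fundamentalLatticeRep 2).N × Fin (fundamentalLatticeRep 2).N × Bool → ℝ) => (l.map (fun a : Edge 3 L × Bool => if a.2 then ((reb y) a.1)ᴴ else (reb y) a.1)).prod) from rfl, h.fderiv]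
    rfl
  rw [hcomp]
  -- `‖H‖² ≤ 2` and `N = 2`
  have hH2 : frobSq H ≤ 2 := by
    rw [hH, frobSq_real_smul, Real.sq_sqrt zero_le_two, frobSq_mul_of_mul_conjTranspose _ _ (mul_conjTranspose_self_of_mem (hU n.1))]
    have hP1 : frobSq Pn ≤ 1 := by
      have h1 : hsForm (fundamentalLatticeRep 2).N Pn Pn ≤ hsForm (fundamentalLatticeRep 2).N (noiseDir n.2) (noiseDir n.2) := hsForm_lieProj_self_le (fundamentalLatticeRep 2) _
      rw [hsForm_noiseDir, if_pos rfl] at h1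
      exact h1
    linarith
  have hN : (Fintype.card (Fin (fundamentalLatticeRep 2).N) : ℝ) = 2 := by rw [Fintype.card_fin]; rfl
  rw [hN] at hb
  have hm : (0 : ℝ) ≤ (l.countP fun a => a.1 = n.1 : ℕ) := Nat.cast_nonneg _
  calc |(fderiv ℝ (fun y : (Edge 3 L × Fin (fundamentalLatticeRep 2).N × Fin (fundamentalLatticeRep 2).N × Bool → ℝ) => (l.map (fun a : Edge 3 L × Bool => if a.2 then ((reb y) a.1)ᴴ else (reb y) a.1)).prod) y₀ v).trace.re|
      ≤ (l.countP fun a => a.1 = n.1 : ℕ) * ((frobSq H + 2) / 2) := hb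
    _ ≤ (l.countP fun a => a.1 = n.1 : ℕ) * 2 := by
        refine mul_le_mul_of_nonneg_left ?_ hm
        linarith
    _ = 2 * (l.countP fun a => a.1 = n.1 : ℕ) := by ring

end Calculus

end Summit.QuantumFields.YangMills.Theorems.ColdStartUniversality
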